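import Summits.QuantumFields.YangMills.Theorems.BalabanUVNodesN15TwoGridDressedDivergenceCoarse
import Summits.QuantumFields.YangMills.Theorems.BalabanUVNodesN15TwoGridLocality
import HarnessLib

/-!
# N15 (NE2) — PROGRAMME D «THE DRESSED SOURCE-DIVERGENCE ENTRY OF THE PAIR OF RECORD», part D-D: ★★ THE JUNK LETTER OF THE BY-PARTS REMAINDERS —
# `G′∘𝔇(M_{b′}, M_{b̄})∘Ȳ` IS RATE-SMALL although the coarse species' OWN remainder `b̄ = ∇̄⁻ā` is NOT the block average of the fine one `b′ = ∇′⁻a′` (no letter on `∇∇a`):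
# conjugation by shifts moves the differences onto the SOURCE of «G∇*» and onto the OUTPUT of the coarse dressed object

WHO ∕ WHEN.  Cell `pub-ymgap`, seat `pub-ymgap-dag-n15-a` (KNIT-BY-NAME seat of Track-A DAG node N15 = NE2, g26); `--kind proof --supports stmt-QuantumFields-27366 --as helper` (K3⁸;
count-neutral).  THEOREMS ONLY (0 `def`).  Over D-C `…TwoGridDressedDivergenceCoarse` (`pull_bshift_sub_id_comp_eq`), parts 34∕35∕3 (`symbOp`, `sT`, `sTinv`, `sT_pow`, `sTinv_pow`,
`symbOp_single_apply`, `kingPr_add_smul_unitVec_of_le`, `hasMaj_sT_pow_comp`, `hasMaj_sTinv_pow_comp`, `hasMaj_finsum`, `hasMaj_smul_ofBlocks`), n15-b g4 (`kingPrV_bshiftEquiv_pow`), II-B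
(`hasMaj_mulOp_comp`, `hasMaj_step`), `T4EtaRateCoeffDefect` (`idef_mulOp_eq`, `hasMaj_pull`), n15-b SiteWords (`hasMaj_diagK_comp_exp`, `hasMaj_exp_mono`), `B11SectG.hasMaj_comp_exp` BY NAME; nothing
in the tree is modified.

WHY.  In the translation-form by-parts step (D-A) the multiplier carries the coefficient's OWN backward quotient `b = n(a − a(·−e_μ))` — the third (3.35) letter.  Under the (C3) transport the coarse
coefficient is `ā = blockAvg a′`, so the coarse species' remainder is `b̄ = N̄(ā − ā(·−ē_μ))`, which is NOT `blockAvg b′` (their difference is a cell-flux commutator; pointwise it is `O(r_b)`, not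
small, and `b′ − b̄∘π` has no sign of smallness: (3.35) carries no letter on `∇∇a`).  D-B isolates this as the junk letter `G′∘𝔇(M_{b′}, M_{b̄})∘Ȳ`.  THIS FILE proves it is rate-small by pure
lattice algebra + the one-step letter of the coarse dressed object `Ȳ` (D-C): with `f′ := a′ − ā∘π` (the legitimate pointwise fit, `|f′| ≤ o_a = O(r_b∕L^k)`) and `R = L^m`,
`b′ − b̄∘π = R⁻¹Σ_{j<R}(b′ − b′(·−je′)) + N̄(f′ − f′(·−Re′))` EXACTLY (telescoping `R⁻¹Σ_{j<R} b′(·−je′) = N̄(a′ − a′(·−Re′))` and King's block-translation law `π(x − Re′) = πx − ē`), and a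
difference multiplier is a shift commutator, `M_{g − g(·−je)} = M_g − τ^{−j}M_gτ^{j}`; hence `G′M_{g−g(·−je)}PȲ = G′M_g(P − τ′^{j}P)Ȳ + (G′ − G′τ′^{−j})M_gτ′^{j}PȲ`: the first factor through King's
prolongation is ONE COARSE STEP of `Ȳ` on part of the cell (`pr(x + je′) ∈ {pr x, pr x + ē}`), the second is `G′(1 − τ′^{−j}) = −n′⁻¹·(G′∇′*_μ)∘Σ_{i<j}τ′^{−i}` — `j ≤ R` SOURCE shifts of
(1.110)'s «G∇*», worth `j∕n′ ≤ 1∕L^k`.  Net: `ζ_b = βr_b·N̄⁻¹D_Y·c_r + N̄⁻¹·C₁e^{2ρ}r_bβ_Y·c_r + βo_a·D_Y·c_r + C₁e^{2ρ}o_aβ_Y·c_r` with `D_Y` the coarse GRADIENT-row constant of `Ȳ` (`= N̄·H_Y`,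
`H_Y = O((L^k)^{−α})` by D-C, and `N̄o_a = O(r_b)`): every summand is rate-small.  NO block average of `b′`, NO cell combinatorics, NO «∇G∇*».

WHAT ([folklore] lattice algebra + bookkeeping; 0 def).
* §23 (one torus) `mulOp_sub_shift_eq` (`M_{g − g(·−je_μ)} = M_g − ρ(s_μ^{−j})∘M_g∘ρ(s_μ^{j})`), `comp_sub_comp_sTinv_pow` (`G′ − G′∘ρ(s_μ^{−j}) = −n⁻¹·(G′∘ρ(n(s_μ⁻¹−1)))∘ρ(Σ_{i<j}s_μ^{−i})`),
  `hasMaj_sum_sTinv_pow_comp` (`ρ(Σ_{i<j}s^{−i})∘T`: `j·Be^{ρ}`), `comp_shiftComm_comp` (abstract regrouping).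
* §24 (two tori) `sub_bq_pull_eq` (the exact decomposition of `b′ − b̄∘π`), `hasMaj_sT_pow_sub_one_pull_comp` (`(ρ′(s′^{j}) − 1)∘P∘T` has every majorant `K ≥ 0` of `(τ̄ − 1)∘T`, `j ≤ L^m`),
  ★★ `hasMaj_junk_bRow` (the junk letter from: «G» `β`, «G∇*_μ» `C₁`, `|b′| ≤ r_b`, `|f′| ≤ o_a`, `Ȳ ≤ β_Ye^{−ρd}`, `∇̄_μȲ ≤ D_Ye^{−ρd}`).

HONEST FRAMING ∕ LIMITS.  Lattice algebra and block-majorant bookkeeping over hypothesis-shaped rows on the torus MODEL of [B5] §1 (D-E instantiates hypothesis-free); abelianised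
scalar-multiplier species, (C3) block-average transport; nothing of [B5]∕[B6]∕[B9] asserted; NE2⁺ NOT PRINTED ∕ NOT proved; no statement of record touched; N15 NOT discharged; K3⁸ OPEN; counts
UNMOVED (typed 28∕28 · discharged 5∕27); one finite torus pair — NOT infinite volume ∕ ℝ⁴ ∕ OS ∕ mass gap ∕ Clay.
-/

noncomputable section

open scoped BigOperators
open Finset

namespace Summit.QuantumFields.YangMills.BalabanUVNodes.N15.TwoGrid

open Literature.MathematicalPhysics.QuantumFieldTheory.Balaban1983to89
open Literature.MathematicalPhysics.QuantumFieldTheory.Balaban1983to89.B11SectG (BlockNorm HasMaj hasMaj_comp hasMaj_comp_exp RowSum)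
open Literature.MathematicalPhysics.QuantumFieldTheory.Balaban1983to89.B11AxialTransport190 (abs_le_loc_ofBlocks loc_ofBlocks_le)
open Literature.MathematicalPhysics.QuantumFieldTheory.Balaban1983to89.T4EtaRateDefect (idef idef_apply)
open Literature.MathematicalPhysics.QuantumFieldTheory.Balaban1983to89.T4EtaRateCoeffDefect (pull pull_apply diagK blockAvg idef_mulOp_eq hasMaj_pull diagK_nonneg)
open Literature.MathematicalPhysics.QuantumFieldTheory.Balaban1983to89.B6RandomWalk (Triangle254)
open Literature.MathematicalPhysics.QuantumFieldTheory.Balaban1983to89.B6Prop26Gluing (mulOp mulOp_apply)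
open Literature.MathematicalPhysics.QuantumFieldTheory.Balaban1983to89.B5Prop11Plancherel (Tor fine unitVec)
open Literature.MathematicalPhysics.QuantumFieldTheory.King1986.Torus (blockOf tdistT tdistT_nonneg)
open Literature.MathematicalPhysics.QuantumFieldTheory.Balaban1983to89.B6UnitTorusCarrier (unitTorusGeo triangle254_unitTorusGeo)
open Summit.QuantumFields.YangMills.BalabanUVNodes.N15.VectorPiece (kingPr kingPrV kingPrV_eq blkFine blkFine_comp_kingPrV bshiftEquiv bshiftEquiv_apply)
open Summit.QuantumFields.YangMills.BalabanUVNodes.N15.BackgroundModel (kappa_ofBlocks)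
open Summit.QuantumFields.YangMills.BalabanUVNodes.N15.BackgroundLayer (hasMaj_step)
open Summit.QuantumFields.YangMills.BalabanUVNodes.N15.SiteLayer (hasMaj_diagK_comp_exp hasMaj_exp_mono)

variable {d : ℕ}

/-! ## §23 One torus: difference multipliers are shift commutators; source differences of «G∇*» -/

section OneTorus

variable (M : Fin (d + 1) → ℕ) [∀ μ, NeZero (M μ)] (n : ℕ) [NeZero n]

omit [∀ μ, NeZero (M μ)] [NeZero n] in
/-- the backward shift power, pointwise: `(ρ(s_κ^{−j})f)(x, a) = f(x − je_κ, a)`. [folklore] -/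
theorem symbOp_sTinv_pow_apply' (κ : Fin (d + 1)) (j : ℕ) (f : Tor (fine n M) × Fin (d + 1) → ℝ) (i : Tor (fine n M) × Fin (d + 1)) :
    symbOp M n (sTinv M n κ ^ j) f i = f (i.1 - j • unitVec (fine n M) κ, i.2) := by
  rw [sTinv_pow, symbOp_single_apply, one_mul, sub_eq_add_neg]

omit [∀ μ, NeZero (M μ)] [NeZero n] in
/-- **A DIFFERENCE MULTIPLIER IS A SHIFT COMMUTATOR**: `M_{g − g(·−je_μ)} = M_g − ρ(s_μ^{−j})∘M_g∘ρ(s_μ^{j})`. [folklore] -/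
theorem mulOp_sub_shift_eq (μ : Fin (d + 1)) (j : ℕ) (g : Tor (fine n M) × Fin (d + 1) → ℝ) :
    (mulOp (fun z => g z - g (z.1 - j • unitVec (fine n M) μ, z.2)) : (Tor (fine n M) × Fin (d + 1) → ℝ) →ₗ[ℝ] (Tor (fine n M) × Fin (d + 1) → ℝ)) =
      mulOp g - symbOp M n (sTinv M n μ ^ j) ∘ₗ mulOp g ∘ₗ symbOp M n (sT M n μ ^ j) := by
  refine LinearMap.ext fun f => funext fun z => ?_
  simp only [LinearMap.sub_apply, LinearMap.comp_apply, Pi.sub_apply, mulOp_apply, symbOp_sTinv_pow_apply', symbOp_sT_pow_apply, sub_add_cancel, sub_mul]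

omit [∀ μ, NeZero (M μ)] in
/-- **A SOURCE DIFFERENCE OF `G′` OVER `j` STEPS IS `j` SHIFTED COPIES OF «G∇*»**: `G′ − G′∘ρ(s_μ^{−j}) = −n⁻¹·(G′∘ρ(n(s_μ⁻¹ − 1)))∘ρ(Σ_{i<j}s_μ^{−i})` (`1 − s^{−j} = (1 − s⁻¹)Σ_{i<j}s^{−i}`).
[cite: Balaban1984PropagatorsI, Prop. 1.2 (1.110) p.35 (entry «G∇*J»: shape)] -/
theorem comp_sub_comp_sTinv_pow {F₂ : Type} [AddCommGroup F₂] [Module ℝ F₂] (G' : (Tor (fine n M) × Fin (d + 1) → ℝ) →ₗ[ℝ] F₂) (μ : Fin (d + 1)) (j : ℕ) :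
    G' - G' ∘ₗ symbOp M n (sTinv M n μ ^ j) = -((n : ℝ)⁻¹ • ((G' ∘ₗ symbOp M n ((n : ℝ) • (sTinv M n μ - 1))) ∘ₗ symbOp M n (∑ i ∈ range j, sTinv M n μ ^ i))) := by
  have hn : (n : ℝ) ≠ 0 := Nat.cast_ne_zero.mpr (NeZero.ne n)
  have h1 : G' - G' ∘ₗ symbOp M n (sTinv M n μ ^ j) = G' ∘ₗ symbOp M n (1 - sTinv M n μ ^ j) := by
    rw [map_sub, map_one, LinearMap.comp_sub, Module.End.one_eq_id, LinearMap.comp_id]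
  have h2 : (1 - sTinv M n μ ^ j : AddMonoidAlgebra ℝ (Tor (fine n M))) = (-((n : ℝ)⁻¹) • ((n : ℝ) • (sTinv M n μ - 1))) * ∑ i ∈ range j, sTinv M n μ ^ i := by
    rw [← mul_neg_geom_sum (sTinv M n μ) j, smul_smul, neg_mul, inv_mul_cancel₀ hn, neg_one_smul, neg_sub]
  rw [h1, h2, map_mul, map_smul, Module.End.mul_eq_comp, LinearMap.smul_comp, LinearMap.comp_smul, ← LinearMap.comp_assoc, neg_smul]

variable {L : ℕ} (k : ℕ) {F₁ : Type} [AddCommGroup F₁] [Module ℝ F₁]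

/-- `ρ(Σ_{i<j} s_κ^{−i})∘T`, `j ≤ n`: majorant `j·B·e^{ρ}`. [folklore] -/
theorem hasMaj_sum_sTinv_pow_comp {b₁ : BlockNorm (unitTorusGeo L k M) F₁} {T : F₁ →ₗ[ℝ] (Tor (fine n M) × Fin (d + 1) → ℝ)} {B ρ : ℝ}
    (hB : 0 ≤ B) (hρ : 0 ≤ ρ) (κ : Fin (d + 1)) {j : ℕ} (hjn : j ≤ n)
    (h : HasMaj b₁ (BlockNorm.ofBlocks (unitTorusGeo L k M) (fun i : Tor (fine n M) × Fin (d + 1) => blockOf n M i.1)) T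
      (fun y y' => B * Real.exp (-(ρ * tdistT M y y')))) :
    HasMaj b₁ (BlockNorm.ofBlocks (unitTorusGeo L k M) (fun i : Tor (fine n M) × Fin (d + 1) => blockOf n M i.1))
      (symbOp M n (∑ i ∈ range j, sTinv M n κ ^ i) ∘ₗ T) (fun y y' => (j : ℝ) * (B * Real.exp ρ * Real.exp (-(ρ * tdistT M y y')))) := by
  rw [map_sum]
  have h2 : ∀ i ∈ range j, HasMaj b₁ (BlockNorm.ofBlocks (unitTorusGeo L k M) (fun i : Tor (fine n M) × Fin (d + 1) => blockOf n M i.1))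
      (symbOp M n (sTinv M n κ ^ i) ∘ₗ T) (fun y y' => B * Real.exp ρ * Real.exp (-(ρ * tdistT M y y'))) :=
    fun i hi => hasMaj_sTinv_pow_comp M k n hB hρ κ ((mem_range.mp hi).le.trans hjn) h
  have hs := hasMaj_finsum (g := unitTorusGeo L k M) (b₁ := b₁)
    (b₂ := BlockNorm.ofBlocks (unitTorusGeo L k M) (fun i : Tor (fine n M) × Fin (d + 1) => blockOf n M i.1))
    (range j) (fun i => symbOp M n (sTinv M n κ ^ i) ∘ₗ T) (fun _ y y' => B * Real.exp ρ * Real.exp (-(ρ * tdistT M y y'))) h2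
  refine (hs.congr fun v => ?_).mono fun y y' => le_of_eq ?_
  · simp only [LinearMap.sum_apply, LinearMap.comp_apply]
  · show ∑ i ∈ range j, B * Real.exp ρ * Real.exp (-(ρ * tdistT M y y')) = _
    rw [sum_const, card_range, nsmul_eq_mul]

end OneTorus

/-- **REGROUPING A SHIFT COMMUTATOR BETWEEN TWO FACTORS** (abstract linear maps): `G′∘(M − B∘M∘T)∘Q = (G′∘M)∘(Q − T∘Q) + (G′ − G′∘B)∘(M∘(T∘Q))`. [folklore] -/
theorem comp_shiftComm_comp {F₀ F₁ F₂ : Type} [AddCommGroup F₀] [Module ℝ F₀] [AddCommGroup F₁] [Module ℝ F₁] [AddCommGroup F₂] [Module ℝ F₂]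
    (G' : F₁ →ₗ[ℝ] F₂) (Mg B T : F₁ →ₗ[ℝ] F₁) (Q : F₀ →ₗ[ℝ] F₁) :
    G' ∘ₗ (Mg - B ∘ₗ Mg ∘ₗ T) ∘ₗ Q = (G' ∘ₗ Mg) ∘ₗ (Q - T ∘ₗ Q) + (G' - G' ∘ₗ B) ∘ₗ (Mg ∘ₗ (T ∘ₗ Q)) := by
  refine LinearMap.ext fun v => ?_
  simp only [LinearMap.comp_apply, LinearMap.sub_apply, LinearMap.add_apply, map_sub]
  abel

/-! ## §24 Two tori: the exact decomposition of `b′ − b̄∘π` and ★★ the junk letter -/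

section TwoTori

variable {L : ℕ} [NeZero L] (M : Fin (d + 1) → ℕ) [∀ μ, NeZero (M μ)] (k m : ℕ)

/-- King's pairing `R = L^m` fine steps BACK is one coarse step back (part 34 `kingPr_add_smul_unitVec` read backwards). [cite: King1986, p.664 (pairing convention)] -/
theorem kingPrV_sub_smul (μ : Fin (d + 1)) (z : Tor (fine (L ^ m * L ^ k) M) × Fin (d + 1)) :
    kingPrV L k m M (z.1 - L ^ m • unitVec (fine (L ^ m * L ^ k) M) μ, z.2) = ((kingPrV L k m M z).1 - unitVec (fine (L ^ k) M) μ, (kingPrV L k m M z).2) := by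
  have h := kingPr_add_smul_unitVec M L k m (z.1 - L ^ m • unitVec (fine (L ^ m * L ^ k) M) μ) μ
  rw [sub_add_cancel] at h
  rw [kingPrV_eq, kingPrV_eq, h]
  simp only [add_sub_cancel_right]

/-- **THE EXACT DECOMPOSITION OF THE BY-PARTS REMAINDERS' MISMATCH**: with `b′ = n′(a′ − a′(·−e′_μ))`, `ā = blockAvg a′`, `b̄ = n̄(ā − ā(·−ē_μ))`, `f′ = a′ − ā∘π`, `R = L^m` (`n′ = R·n̄`):
`b′ − b̄∘π = R⁻¹Σ_{j<R}(b′ − b′(·−je′_μ)) + n̄(f′ − f′(·−Re′_μ))` — the telescoping `R⁻¹Σ_{j<R}b′(·−je′) = n̄(a′ − a′(·−Re′))` and the block-translation law. [cite: King1986, p.664 (pairing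
convention); Balaban1985BackgroundPropagators, (3.35) p.396 (the letters `|A|`, `|∇^ηA|`: shape)] -/
theorem sub_bq_pull_eq (μ : Fin (d + 1)) (a' : Tor (fine (L ^ m * L ^ k) M) × Fin (d + 1) → ℝ) (z : Tor (fine (L ^ m * L ^ k) M) × Fin (d + 1)) :
    ((L ^ m * L ^ k : ℕ) : ℝ) * (a' z - a' (z.1 - unitVec (fine (L ^ m * L ^ k) M) μ, z.2)) -
        ((L ^ k : ℕ) : ℝ) * (blockAvg (kingPrV L k m M) a' (kingPrV L k m M z) -
          blockAvg (kingPrV L k m M) a' ((kingPrV L k m M z).1 - unitVec (fine (L ^ k) M) μ, (kingPrV L k m M z).2)) =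
      ((L ^ m : ℕ) : ℝ)⁻¹ * ∑ j ∈ range (L ^ m), (((L ^ m * L ^ k : ℕ) : ℝ) * (a' z - a' (z.1 - unitVec (fine (L ^ m * L ^ k) M) μ, z.2)) -
          ((L ^ m * L ^ k : ℕ) : ℝ) * (a' (z.1 - j • unitVec (fine (L ^ m * L ^ k) M) μ, z.2) -
            a' ((z.1 - j • unitVec (fine (L ^ m * L ^ k) M) μ, z.2).1 - unitVec (fine (L ^ m * L ^ k) M) μ, (z.1 - j • unitVec (fine (L ^ m * L ^ k) M) μ, z.2).2))) +
        ((L ^ k : ℕ) : ℝ) * ((a' z - blockAvg (kingPrV L k m M) a' (kingPrV L k m M z)) -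
          (a' (z.1 - L ^ m • unitVec (fine (L ^ m * L ^ k) M) μ, z.2) - blockAvg (kingPrV L k m M) a' (kingPrV L k m M (z.1 - L ^ m • unitVec (fine (L ^ m * L ^ k) M) μ, z.2)))) := by
  have hL0 : 0 < L := Nat.pos_of_ne_zero (NeZero.ne L)
  have hR : ((L ^ m : ℕ) : ℝ) ≠ 0 := by positivity
  -- telescoping along `μ`: `Σ_{j<R} (a′(x − je) − a′(x − (j+1)e)) = a′(x) − a′(x − Re)`
  have htel : ∑ j ∈ range (L ^ m), (a' (z.1 - j • unitVec (fine (L ^ m * L ^ k) M) μ, z.2) -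
      a' ((z.1 - j • unitVec (fine (L ^ m * L ^ k) M) μ, z.2).1 - unitVec (fine (L ^ m * L ^ k) M) μ, (z.1 - j • unitVec (fine (L ^ m * L ^ k) M) μ, z.2).2)) =
      a' z - a' (z.1 - L ^ m • unitVec (fine (L ^ m * L ^ k) M) μ, z.2) := by
    have h := Finset.sum_range_sub' (fun j => a' (z.1 - j • unitVec (fine (L ^ m * L ^ k) M) μ, z.2)) (L ^ m)
    simp only [zero_smul, sub_zero] at h
    rw [← h]
    refine Finset.sum_congr rfl fun j _ => ?_
    rw [add_smul, one_smul, sub_add_eq_sub_sub]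
  rw [kingPrV_sub_smul, Finset.sum_sub_distrib, sum_const, card_range, nsmul_eq_mul, ← Finset.mul_sum, htel]
  push_cast
  field_simp
  ring

/-- **SHIFTING A PROLONGATION BY `j ≤ L^m` FINE STEPS COSTS ONE COARSE STEP OF THE PROLONGED OBJECT**: `(ρ′(s′_κ^{j}) − 1)∘P∘T` (fine unit blocks) has every block majorant `K ≥ 0` that
`(τ̄_κ − 1)∘T` (coarse King blocks) has — pointwise `(Tμ)(pr(x′ + je′)) − (Tμ)(pr x′)` with `pr(x′ + je′) ∈ {pr x′, pr x′ + ē}`. [cite: King1986, p.664 (pairing convention «x′ ∈ B^n(x)»)] -/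
theorem hasMaj_sT_pow_sub_one_pull_comp {F₁ : Type} [AddCommGroup F₁] [Module ℝ F₁] {b₁ : BlockNorm (unitTorusGeo L k M) F₁} {T : F₁ →ₗ[ℝ] (Tor (fine (L ^ k) M) × Fin (d + 1) → ℝ)}
    {K : Tor M → Tor M → ℝ} (hK : ∀ y y', 0 ≤ K y y') (κ : Fin (d + 1)) {j : ℕ} (hj : j ≤ L ^ m)
    (h : HasMaj b₁ (BlockNorm.ofBlocks (unitTorusGeo L k M) (blkFine L k M)) ((pull ⇑(bshiftEquiv M (L ^ k) κ) - LinearMap.id) ∘ₗ T) K) :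
    HasMaj b₁ (BlockNorm.ofBlocks (unitTorusGeo L k M) (fun i : Tor (fine (L ^ m * L ^ k) M) × Fin (d + 1) => blockOf (L ^ m * L ^ k) M i.1))
      ((symbOp M (L ^ m * L ^ k) (sT M (L ^ m * L ^ k) κ ^ j) - 1) ∘ₗ (pull (kingPrV L k m M) ∘ₗ T)) K := by
  intro y' v hv y
  refine loc_ofBlocks_le (g := unitTorusGeo L k M) _ _ (mul_nonneg (hK y y') (b₁.loc_nonneg y' v)) fun z hz => ?_
  have hblk : blkFine L k M (kingPrV L k m M z) = y := by rw [← hz]; exact congrFun (blkFine_comp_kingPrV M L k m) z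
  rw [LinearMap.comp_apply, LinearMap.sub_apply, Pi.sub_apply, symbOp_sT_pow_apply, Module.End.one_apply, LinearMap.comp_apply, pull_apply, pull_apply, kingPrV_eq, kingPrV_eq]
  obtain ⟨δ, hδ, hpr⟩ := kingPr_add_smul_unitVec_of_le M L k m z.1 κ hj
  rw [hpr]
  interval_cases δ
  · rw [zero_smul, add_zero, sub_self, abs_zero]
    exact mul_nonneg (hK y y') (b₁.loc_nonneg y' v)
  · rw [one_smul]
    have hval : T v (kingPr L k m M z.1 + unitVec (fine (L ^ k) M) κ, z.2) - T v (kingPr L k m M z.1, z.2) =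
        (((pull ⇑(bshiftEquiv M (L ^ k) κ) - LinearMap.id) ∘ₗ T : F₁ →ₗ[ℝ] (Tor (fine (L ^ k) M) × Fin (d + 1) → ℝ)) v) (kingPrV L k m M z) := by
      rw [LinearMap.comp_apply, LinearMap.sub_apply, Pi.sub_apply, pull_apply, bshiftEquiv_apply, LinearMap.id_apply, kingPrV_eq]
    rw [hval]
    exact (abs_le_loc_ofBlocks (g := unitTorusGeo L k M) (blkFine L k M) _ hblk).trans (h y' v hv y)

set_option maxHeartbeats 800000 in
/-- ★★ **THE JUNK LETTER OF THE BY-PARTS REMAINDERS IS RATE-SMALL.**  Data on the torus pair of record (`n = L^k`, `n′ = L^mL^k`, pairing `P`): a fine operator `G′` with «G» `≤ βe^{−δd}` and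
«G∇*_μ» `G′∘ρ′(n′(s_μ⁻¹−1)) ≤ C₁e^{−δd}`; a fine coefficient `a′` (component `μ` of the species) with `|n′(a′ − a′(·−e′_μ))| ≤ r_b` and the pointwise fit `|a′ − ā∘π| ≤ o_a` (`ā = blockAvg a′`); a
coarse operator `Ȳ` (the dressed source divergence) with `Ȳ ≤ β_Ye^{−ρd}` and the gradient row `ρ(sD_μ n)∘Ȳ ≤ D_Ye^{−ρd}`; `ρ + σ ≤ δ`.  THEN
`G′∘𝔇(M_{b′}, M_{b̄})∘Ȳ ≤ (βr_b·n⁻¹D_Y + n⁻¹·C₁e^{2ρ}r_bβ_Y + βo_a·D_Y + C₁e^{2ρ}o_aβ_Y)·c_r·e^{−ρd}` with `b′ = n′(a′ − a′(·−e′))`, `b̄ = n(ā − ā(·−ē))` — rate-small once `D_Y = n·H_Y` with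
`H_Y` small (D-C) and `n·o_a = O(r_b)`. [cite: Balaban1985BackgroundPropagators, (3.35) p.396 (letters), (3.52) p.400, (3.62)–(3.65) pp.402–403 (mechanism); Balaban1984PropagatorsI, Prop. 1.2
(1.110) p.35 (rows «G», «G∇*»); King1986, p.664 (pairing)] -/
theorem hasMaj_junk_bRow {σ cr : ℝ} (hrow : RowSum (unitTorusGeo L k M) σ cr) {ρ δ β C₁ rb oa βY DY : ℝ} (hρ : 0 ≤ ρ) (hρδ : ρ + σ ≤ δ) (hβ : 0 ≤ β) (hC₁ : 0 ≤ C₁)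
    (hrb : 0 ≤ rb) (hoa : 0 ≤ oa) (hβY : 0 ≤ βY) (hDY : 0 ≤ DY) (μ : Fin (d + 1))
    {G' : (Tor (fine (L ^ m * L ^ k) M) × Fin (d + 1) → ℝ) →ₗ[ℝ] (Tor (fine (L ^ m * L ^ k) M) × Fin (d + 1) → ℝ)} {a' : Tor (fine (L ^ m * L ^ k) M) × Fin (d + 1) → ℝ}
    {Y : (Tor (fine (L ^ k) M) × Fin (d + 1) → ℝ) →ₗ[ℝ] (Tor (fine (L ^ k) M) × Fin (d + 1) → ℝ)}
    (hG' : HasMaj (BlockNorm.ofBlocks (unitTorusGeo L k M) (fun i : Tor (fine (L ^ m * L ^ k) M) × Fin (d + 1) => blockOf (L ^ m * L ^ k) M i.1))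
      (BlockNorm.ofBlocks (unitTorusGeo L k M) (fun i : Tor (fine (L ^ m * L ^ k) M) × Fin (d + 1) => blockOf (L ^ m * L ^ k) M i.1)) G' (fun y y' => β * Real.exp (-(δ * tdistT M y y'))))
    (hS' : HasMaj (BlockNorm.ofBlocks (unitTorusGeo L k M) (fun i : Tor (fine (L ^ m * L ^ k) M) × Fin (d + 1) => blockOf (L ^ m * L ^ k) M i.1))
      (BlockNorm.ofBlocks (unitTorusGeo L k M) (fun i : Tor (fine (L ^ m * L ^ k) M) × Fin (d + 1) => blockOf (L ^ m * L ^ k) M i.1))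
      (G' ∘ₗ symbOp M (L ^ m * L ^ k) (((L ^ m * L ^ k : ℕ) : ℝ) • (sTinv M (L ^ m * L ^ k) μ - 1))) (fun y y' => C₁ * Real.exp (-(δ * tdistT M y y'))))
    (hb' : ∀ z, |((L ^ m * L ^ k : ℕ) : ℝ) * (a' z - a' (z.1 - unitVec (fine (L ^ m * L ^ k) M) μ, z.2))| ≤ rb)
    (hfa : ∀ z, |a' z - blockAvg (kingPrV L k m M) a' (kingPrV L k m M z)| ≤ oa)
    (hY : HasMaj (BlockNorm.ofBlocks (unitTorusGeo L k M) (blkFine L k M)) (BlockNorm.ofBlocks (unitTorusGeo L k M) (blkFine L k M)) Y (fun y y' => βY * Real.exp (-(ρ * tdistT M y y'))))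
    (hYD : HasMaj (BlockNorm.ofBlocks (unitTorusGeo L k M) (blkFine L k M)) (BlockNorm.ofBlocks (unitTorusGeo L k M) (blkFine L k M))
      (symbOp M (L ^ k) (sD M (L ^ k) μ ((L ^ k : ℕ) : ℝ)) ∘ₗ Y) (fun y y' => DY * Real.exp (-(ρ * tdistT M y y')))) :
    HasMaj (BlockNorm.ofBlocks (unitTorusGeo L k M) (blkFine L k M))
      (BlockNorm.ofBlocks (unitTorusGeo L k M) (fun i : Tor (fine (L ^ m * L ^ k) M) × Fin (d + 1) => blockOf (L ^ m * L ^ k) M i.1))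
      (G' ∘ₗ (idef (pull (kingPrV L k m M)) (pull (kingPrV L k m M))
          (mulOp fun z => ((L ^ m * L ^ k : ℕ) : ℝ) * (a' z - a' (z.1 - unitVec (fine (L ^ m * L ^ k) M) μ, z.2)))
          (mulOp fun z => ((L ^ k : ℕ) : ℝ) * (blockAvg (kingPrV L k m M) a' z - blockAvg (kingPrV L k m M) a' (z.1 - unitVec (fine (L ^ k) M) μ, z.2))) ∘ₗ Y))
      (fun y y' => (β * rb * ((((L ^ k : ℕ) : ℝ))⁻¹ * DY) + (((L ^ k : ℕ) : ℝ))⁻¹ * (C₁ * (rb * (βY * Real.exp ρ) * Real.exp ρ)) + β * oa * DY +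
          C₁ * (oa * (βY * Real.exp ρ) * Real.exp ρ)) * cr * Real.exp (-(ρ * tdistT M y y'))) := by
  have htri : Triangle254 (unitTorusGeo L k M) := triangle254_unitTorusGeo L k M
  have hd : ∀ a b : (unitTorusGeo L k M).Site, 0 ≤ (unitTorusGeo L k M).dist a b := fun a b => tdistT_nonneg M a b
  have hL0 : 0 < L := Nat.pos_of_ne_zero (NeZero.ne L)
  have hRpos : 0 < L ^ m := pow_pos hL0 m
  have hRr : (0 : ℝ) < ((L ^ m : ℕ) : ℝ) := by exact_mod_cast hRpos
  have hn' : (0 : ℝ) < ((L ^ m * L ^ k : ℕ) : ℝ) := by positivity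
  have hnk : (0 : ℝ) < ((L ^ k : ℕ) : ℝ) := by positivity
  have hRn' : L ^ m ≤ L ^ m * L ^ k := Nat.le_mul_of_pos_right _ (pow_pos hL0 k)
  have hcast : ((L ^ m * L ^ k : ℕ) : ℝ) = ((L ^ m : ℕ) : ℝ) * ((L ^ k : ℕ) : ℝ) := by push_cast; ring
  -- names
  set P := pull (kingPrV L k m M) with hP_def
  set bc := BlockNorm.ofBlocks (unitTorusGeo L k M) (blkFine L k M) with hbc
  set bf := BlockNorm.ofBlocks (unitTorusGeo L k M) (fun i : Tor (fine (L ^ m * L ^ k) M) × Fin (d + 1) => blockOf (L ^ m * L ^ k) M i.1) with hbf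
  set b' : Tor (fine (L ^ m * L ^ k) M) × Fin (d + 1) → ℝ := fun z => ((L ^ m * L ^ k : ℕ) : ℝ) * (a' z - a' (z.1 - unitVec (fine (L ^ m * L ^ k) M) μ, z.2)) with hb'_def
  set ab : Tor (fine (L ^ k) M) × Fin (d + 1) → ℝ := blockAvg (kingPrV L k m M) a' with hab_def
  set bq : Tor (fine (L ^ k) M) × Fin (d + 1) → ℝ := fun z => ((L ^ k : ℕ) : ℝ) * (ab z - ab (z.1 - unitVec (fine (L ^ k) M) μ, z.2)) with hbq_def
  set f' : Tor (fine (L ^ m * L ^ k) M) × Fin (d + 1) → ℝ := fun z => a' z - ab (kingPrV L k m M z) with hf'_def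
  set S' := G' ∘ₗ symbOp M (L ^ m * L ^ k) (((L ^ m * L ^ k : ℕ) : ℝ) • (sTinv M (L ^ m * L ^ k) μ - 1)) with hS'_def
  set Bj : ℕ → (Tor (fine (L ^ m * L ^ k) M) × Fin (d + 1) → ℝ) →ₗ[ℝ] (Tor (fine (L ^ m * L ^ k) M) × Fin (d + 1) → ℝ) :=
    fun j => symbOp M (L ^ m * L ^ k) (sTinv M (L ^ m * L ^ k) μ ^ j) with hBj
  set Tj : ℕ → (Tor (fine (L ^ m * L ^ k) M) × Fin (d + 1) → ℝ) →ₗ[ℝ] (Tor (fine (L ^ m * L ^ k) M) × Fin (d + 1) → ℝ) :=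
    fun j => symbOp M (L ^ m * L ^ k) (sT M (L ^ m * L ^ k) μ ^ j) with hTj
  set Q := P ∘ₗ Y with hQ_def
  -- (1) the multiplier defect is a fine multiplier after the prolongation, and its exact decomposition
  have hu : idef P P (mulOp b') (mulOp bq) = mulOp (fun z => ((L ^ m : ℕ) : ℝ)⁻¹ * ∑ j ∈ range (L ^ m), (b' z - b' (z.1 - j • unitVec (fine (L ^ m * L ^ k) M) μ, z.2)) +
      ((L ^ k : ℕ) : ℝ) * (f' z - f' (z.1 - L ^ m • unitVec (fine (L ^ m * L ^ k) M) μ, z.2))) ∘ₗ P := by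
    rw [hP_def, idef_mulOp_eq]
    congr 1
    congr 1
    funext z
    exact sub_bq_pull_eq M k m μ a' z
  have hmul : (mulOp (fun z => ((L ^ m : ℕ) : ℝ)⁻¹ * ∑ j ∈ range (L ^ m), (b' z - b' (z.1 - j • unitVec (fine (L ^ m * L ^ k) M) μ, z.2)) +
      ((L ^ k : ℕ) : ℝ) * (f' z - f' (z.1 - L ^ m • unitVec (fine (L ^ m * L ^ k) M) μ, z.2))) :
        (Tor (fine (L ^ m * L ^ k) M) × Fin (d + 1) → ℝ) →ₗ[ℝ] (Tor (fine (L ^ m * L ^ k) M) × Fin (d + 1) → ℝ)) =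
      ((L ^ m : ℕ) : ℝ)⁻¹ • ∑ j ∈ range (L ^ m), (mulOp b' - Bj j ∘ₗ mulOp b' ∘ₗ Tj j) + ((L ^ k : ℕ) : ℝ) • (mulOp f' - Bj (L ^ m) ∘ₗ mulOp f' ∘ₗ Tj (L ^ m)) := by
    simp only [hBj, hTj, ← mulOp_sub_shift_eq]
    refine LinearMap.ext fun g => funext fun z => ?_
    simp only [mulOp_apply, LinearMap.add_apply, LinearMap.smul_apply, LinearMap.sum_apply, Pi.add_apply, Pi.smul_apply, Finset.sum_apply, smul_eq_mul, ← Finset.sum_mul]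
    ring
  -- (2) the operator, regrouped
  have hop : G' ∘ₗ (idef P P (mulOp b') (mulOp bq) ∘ₗ Y) =
      ((L ^ m : ℕ) : ℝ)⁻¹ • ∑ j ∈ range (L ^ m), ((G' ∘ₗ mulOp b') ∘ₗ (Q - Tj j ∘ₗ Q) + (G' - G' ∘ₗ Bj j) ∘ₗ (mulOp b' ∘ₗ (Tj j ∘ₗ Q))) +
        ((L ^ k : ℕ) : ℝ) • ((G' ∘ₗ mulOp f') ∘ₗ (Q - Tj (L ^ m) ∘ₗ Q) + (G' - G' ∘ₗ Bj (L ^ m)) ∘ₗ (mulOp f' ∘ₗ (Tj (L ^ m) ∘ₗ Q))) := by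
    rw [hu, hmul]
    simp only [← comp_shiftComm_comp]
    refine LinearMap.ext fun v => ?_
    simp only [hQ_def, LinearMap.comp_apply, LinearMap.add_apply, LinearMap.smul_apply, LinearMap.sum_apply, map_add, map_smul, map_sum]
  -- (3) the letters
  have hQ : HasMaj bc (BlockNorm.ofBlocks (unitTorusGeo L k M) (fun i : Tor (fine (L ^ m * L ^ k) M) × Fin (d + 1) => blockOf (L ^ m * L ^ k) M i.1)) Q
      (fun y y' => βY * Real.exp (-(ρ * tdistT M y y'))) := by
    have h := hasMaj_diagK_comp_exp (g := unitTorusGeo L k M) (blkFine L k M) zero_le_one (hasMaj_pull (g := unitTorusGeo L k M) (blkFine L k M) (kingPrV L k m M)) hY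
    rw [blkFine_comp_kingPrV] at h
    exact h.mono fun y y' => le_of_eq (by ring)
  have hβYρ : 0 ≤ βY * Real.exp ρ := by positivity
  have hTQ : ∀ {j : ℕ}, j ≤ L ^ m → HasMaj bc bf (Tj j ∘ₗ Q) (fun y y' => βY * Real.exp ρ * Real.exp (-(ρ * tdistT M y y'))) :=
    fun hj => hasMaj_sT_pow_comp M k (L ^ m * L ^ k) (b₁ := bc) hβY hρ μ (hj.trans hRn') hQ
  -- the face factor `Q − τ′^{j}Q`: one coarse step of `Y`
  have hstep : HasMaj bc bc ((pull ⇑(bshiftEquiv M (L ^ k) μ) - LinearMap.id) ∘ₗ Y) (fun y y' => |(((L ^ k : ℕ) : ℝ))⁻¹| * (DY * Real.exp (-(ρ * tdistT M y y')))) := by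
    rw [pull_bshift_sub_id_comp_eq M (L ^ k) μ Y]
    exact hasMaj_smul_ofBlocks (g := unitTorusGeo L k M) (blkFine L k M) (fun _ _ => mul_nonneg hDY (Real.exp_nonneg _)) _ hYD
  have hface : ∀ {j : ℕ}, j ≤ L ^ m → HasMaj bc bf (Q - Tj j ∘ₗ Q) (fun y y' => (((L ^ k : ℕ) : ℝ))⁻¹ * DY * Real.exp (-(ρ * tdistT M y y'))) := by
    intro j hj
    have h := hasMaj_sT_pow_sub_one_pull_comp M k m (b₁ := bc) (fun y y' => mul_nonneg (abs_nonneg _) (mul_nonneg hDY (Real.exp_nonneg _))) μ hj hstep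
    have hQT : Q - Tj j ∘ₗ Q = -((symbOp M (L ^ m * L ^ k) (sT M (L ^ m * L ^ k) μ ^ j) - 1) ∘ₗ (P ∘ₗ Y)) := by
      rw [LinearMap.sub_comp, Module.End.one_eq_id, LinearMap.id_comp, neg_sub]
    rw [hQT]
    exact h.neg.mono fun y y' => le_of_eq (by rw [abs_of_nonneg (inv_nonneg.mpr hnk.le)]; ring)
  -- (A) `G′M_g(Q − τ′^jQ)`
  have hA : ∀ {g : Tor (fine (L ^ m * L ^ k) M) × Fin (d + 1) → ℝ} {rg : ℝ}, 0 ≤ rg → (∀ z, |g z| ≤ rg) → ∀ {j : ℕ}, j ≤ L ^ m →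
      HasMaj bc bf ((G' ∘ₗ mulOp g) ∘ₗ (Q - Tj j ∘ₗ Q)) (fun y y' => bf.κ * (β * rg) * ((((L ^ k : ℕ) : ℝ))⁻¹ * DY) * cr * Real.exp (-(ρ * tdistT M y y'))) := by
    intro g rg hrg hg j hj
    have hfront : HasMaj bf bf (G' ∘ₗ mulOp g) (fun y y' => β * rg * Real.exp (-(δ * (unitTorusGeo L k M).dist y y'))) :=
      hasMaj_step (g := unitTorusGeo L k M) (fun i : Tor (fine (L ^ m * L ^ k) M) × Fin (d + 1) => blockOf (L ^ m * L ^ k) M i.1) hβ hrg hG' hg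
    exact hasMaj_comp_exp (b₁ := bc) (b₂ := bf) (b₃ := bf) htri hd hrow (mul_nonneg hβ hrg) (by positivity) hρ le_rfl hρδ hfront (hface hj)
  -- (B) `(G′ − G′B^j)M_gτ′^jQ = −n′⁻¹·S′∘Σ_{i<j}B^i∘(M_gτ′^jQ)`
  have hcr : 0 ≤ cr := by
    exact hrow.nonneg (fun μ => (0 : ZMod (M μ)))
  have hB : ∀ {g : Tor (fine (L ^ m * L ^ k) M) × Fin (d + 1) → ℝ} {rg : ℝ}, 0 ≤ rg → (∀ z, |g z| ≤ rg) → ∀ {j : ℕ}, j ≤ L ^ m →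
      HasMaj bc bf ((G' - G' ∘ₗ Bj j) ∘ₗ (mulOp g ∘ₗ (Tj j ∘ₗ Q)))
        (fun y y' => |(((L ^ m * L ^ k : ℕ) : ℝ))⁻¹| * (bf.κ * C₁ * ((j : ℝ) * (rg * (βY * Real.exp ρ) * Real.exp ρ)) * cr * Real.exp (-(ρ * tdistT M y y')))) := by
    intro g rg hrg hg j hj
    have hW : HasMaj bc bf (mulOp g ∘ₗ (Tj j ∘ₗ Q)) (fun y y' => rg * (βY * Real.exp ρ) * Real.exp (-(ρ * tdistT M y y'))) :=
      (hasMaj_mulOp_comp (g := unitTorusGeo L k M) (fun i : Tor (fine (L ^ m * L ^ k) M) × Fin (d + 1) => blockOf (L ^ m * L ^ k) M i.1)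
        (fun _ _ => mul_nonneg hβYρ (Real.exp_nonneg _)) hrg hg (hTQ hj)).mono fun y y' => le_of_eq (by ring)
    have hSh := hasMaj_sum_sTinv_pow_comp M (L ^ m * L ^ k) k (b₁ := bc) (mul_nonneg hrg hβYρ) hρ μ (hj.trans hRn') hW
    have hSS : HasMaj bc bf (S' ∘ₗ (symbOp M (L ^ m * L ^ k) (∑ i ∈ range j, sTinv M (L ^ m * L ^ k) μ ^ i) ∘ₗ (mulOp g ∘ₗ (Tj j ∘ₗ Q))))
        (fun y y' => bf.κ * C₁ * ((j : ℝ) * (rg * (βY * Real.exp ρ) * Real.exp ρ)) * cr * Real.exp (-(ρ * tdistT M y y'))) :=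
      hasMaj_comp_exp (b₁ := bc) (b₂ := bf) (b₃ := bf) htri hd hrow hC₁ (by positivity) hρ le_rfl hρδ hS' (hSh.mono fun y y' => le_of_eq (by ring))
    have heq : (G' - G' ∘ₗ Bj j) ∘ₗ (mulOp g ∘ₗ (Tj j ∘ₗ Q)) =
        -((((L ^ m * L ^ k : ℕ) : ℝ))⁻¹ • (S' ∘ₗ (symbOp M (L ^ m * L ^ k) (∑ i ∈ range j, sTinv M (L ^ m * L ^ k) μ ^ i) ∘ₗ (mulOp g ∘ₗ (Tj j ∘ₗ Q))))) := by
      simp only [hBj, hS'_def]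
      rw [comp_sub_comp_sTinv_pow M (L ^ m * L ^ k) G' μ j]
      simp only [LinearMap.neg_comp, LinearMap.smul_comp, LinearMap.comp_assoc]
    rw [heq]
    have hKnn : ∀ y y' : Tor M, 0 ≤ bf.κ * C₁ * ((j : ℝ) * (rg * (βY * Real.exp ρ) * Real.exp ρ)) * cr * Real.exp (-(ρ * tdistT M y y')) := fun y y' => by
      have := bf.κ_nonneg; positivity
    exact (hasMaj_smul_ofBlocks (g := unitTorusGeo L k M) (fun i : Tor (fine (L ^ m * L ^ k) M) × Fin (d + 1) => blockOf (L ^ m * L ^ k) M i.1) hKnn _ hSS).neg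
  -- multiplier letters
  have hf' : ∀ z, |f' z| ≤ oa := fun z => hfa z
  -- (4) assembly
  have habs1 : |(((L ^ m * L ^ k : ℕ) : ℝ))⁻¹| = (((L ^ m * L ^ k : ℕ) : ℝ))⁻¹ := abs_of_nonneg (inv_nonneg.mpr hn'.le)
  have hjsum := hasMaj_finsum (b₁ := bc) (b₂ := bf) (range (L ^ m))
    (fun j => (G' ∘ₗ mulOp b') ∘ₗ (Q - Tj j ∘ₗ Q) + (G' - G' ∘ₗ Bj j) ∘ₗ (mulOp b' ∘ₗ (Tj j ∘ₗ Q)))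
    (fun _ y y' => bf.κ * (β * rb) * ((((L ^ k : ℕ) : ℝ))⁻¹ * DY) * cr * Real.exp (-(ρ * tdistT M y y')) +
      (((L ^ m * L ^ k : ℕ) : ℝ))⁻¹ * (bf.κ * C₁ * (((L ^ m : ℕ) : ℝ) * (rb * (βY * Real.exp ρ) * Real.exp ρ)) * cr * Real.exp (-(ρ * tdistT M y y'))))
    fun j hj => by
      have hjR : j ≤ L ^ m := (mem_range.mp hj).le
      refine ((hA hrb hb' hjR).add (hB hrb hb' hjR)).mono fun y y' => add_le_add le_rfl ?_
      rw [habs1]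
      refine mul_le_mul_of_nonneg_left (mul_le_mul_of_nonneg_right (mul_le_mul_of_nonneg_right (mul_le_mul_of_nonneg_left
        (mul_le_mul_of_nonneg_right (by exact_mod_cast hjR) (by positivity)) (by rw [hbf, kappa_ofBlocks]; positivity)) hcr) (Real.exp_nonneg _)) (inv_nonneg.mpr hn'.le)
  have hRterm := (hA hoa hf' le_rfl).add (hB hoa hf' le_rfl)
  rw [hop]
  refine ((hasMaj_smul_ofBlocks (g := unitTorusGeo L k M) (fun i : Tor (fine (L ^ m * L ^ k) M) × Fin (d + 1) => blockOf (L ^ m * L ^ k) M i.1)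
    (fun y y' => sum_nonneg fun j _ => by rw [hbf, kappa_ofBlocks]; positivity) _ hjsum).add
    (hasMaj_smul_ofBlocks (g := unitTorusGeo L k M) (fun i : Tor (fine (L ^ m * L ^ k) M) × Fin (d + 1) => blockOf (L ^ m * L ^ k) M i.1)
    (fun y y' => by rw [hbf, kappa_ofBlocks, habs1]; positivity) _ hRterm)).mono fun y y' => le_of_eq ?_
  rw [sum_const, card_range, nsmul_eq_mul, habs1, abs_of_nonneg (inv_nonneg.mpr hRr.le), abs_of_nonneg hnk.le, hbf, kappa_ofBlocks, hcast]
  field_simp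
  ring

end TwoTori

end Summit.QuantumFields.YangMills.BalabanUVNodes.N15.TwoGrid

end
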